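import Literature.AlgebraicGeometry.HodgeTheory.FermatLevelMapPullback
import Literature.AlgebraicGeometry.HodgeTheory.SurjectivePullbackAlgebraicClasses
import Literature.AlgebraicGeometry.HodgeTheory.FermatDiagonalAction
import Literature.AlgebraicGeometry.HodgeTheory.FermatAffineChart
import Summits.HodgeConjecture.HodgeConjecture.Theorems.Ring2AbelianAllFermatQuotientEtaleStep
import HarnessLib

/-!
# Level reduction of Fermat eigenspace algebraicity along the étale step `z ↦ zᵉ`, I: equivariance, surjectivity, descent (WEIL-2 gen 34, FERMAT-G33 §2 LEMMA L (ii) in the kernel; fact-free)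

research route, not a corollary; conditional on HC_CM plus one named minimal statement.

Cell `pub-hodge-ring2-ab-*` (ALL ABELIAN VARIETIES), seat WEIL-2 gen 34, account
`run/shared/lean/pub/pub-hodge-ring2/pub-hodge-ring2-ab-weil-2/LEVEL-G34.md` §2; predecessor account FERMAT-G33 §2 (THEOREM F_q♮, LEMMA L).
Sequel: `Ring2AbelianAllFermatLevelReductionOrbit` (middle degree: `λ^* V_m(α) = V_{em}(e·α)`, LEMMA L (ii) as an `iff`, orbit form).

THE GEOMETRY.  THEOREM F_q♮ (FERMAT-G33) reduces the algebraicity of Schoen's Hodge structure `U` of a cyclic `μ_{em}`-cover with an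
étale `μ_e`-step to the algebraicity of the eigenlines `V_m(t·α)`, `t ∈ (ℤ/m)ˣ`, of the Fermat variety of the LOWER degree `m`, while the
cell's tables (TABLE Q, column `e`) book the SAME habitat under the character `e·α` of the Fermat variety of degree `em`.  The bridge is
LEMMA L (ii) of FERMAT-G33 §2: along the level map `λ : Xⁿ_{em} → Xⁿ_m`, `[z] ↦ [zᵉ]` (the tree's `fermatLevelMap`, Shioda–Katsura 1979 §1),
`λ^* V_m(α) = V_{em}(e·α)` and `λ_* λ^* = deg λ`, so `⊕_t V_m(tα)` is spanned by algebraic classes iff `⊕_{t'} V_{em}(t'·eα)` is.  In the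
account this was a five-line prose argument; ab-ref's audit list (R-123, Q33.1) names it among the steps to re-derive.  THIS FILE AND ITS
SEQUEL PROVE IT ON THE TREE'S CARRIERS (`complexBetti`, `fermatEigenspace`, `algebraicClasses`), with no named fact and no new definition:

* §1 `fermatCharacter_levelMul` — `χ_{eα}(a) = χ_α(aᵉ)` for `a ∈ μ_{em}ⁿ⁺²` (`aᵉ ∈ μ_mⁿ⁺²`, `pow_mem_fermatGroup`);
* §2 `map_fermatLevelMap_diagonalMap` — **equivariance on complex points**: `λ(g_a x) = g_{aᵉ}(λ x)` (both have homogeneous coordinates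
  `[aᵢᵉ zᵢᵉ]`; the homogeneous-coordinate map of `Xⁿ_m` is injective), hence on cohomology `g_a^* ∘ λ^* = λ^* ∘ g_{aᵉ}^*`
  (`map_diagonalMap_map_fermatLevelMap`) and **`λ^* V_m(α) ⊆ V_{em}(e·α)`** in every degree (`map_fermatEigenspace_le_levelMul`);
* §3 `surjective_fermatLevelMap` — `λ` is surjective (onto on `ℂ`-points by extracting `e`-th roots; finite, hence closed, onto the
  Jacobson scheme `Xⁿ_m`);
* §4 **LEMMA L (ii), descent half** `fermatEigenspace_le_algebraicClasses_of_levelMul`: if `V_{em}(e·α) ⊆ H²ᵖ` consists of algebraic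
  classes then so does `V_m(α)` — by §2 and the tree's degree trick `λ_* λ^* = c·id`, `c ≠ 0`
  (`mem_algebraicClasses_of_map_mem_of_surjective`, Voisin I Rem. 7.29 / Schoen 1988 proof of Cor. 3.1), in EVERY degree `2p` and dimension
  `n ≥ 1` — this is the direction «`α ∈ 𝔈_{em} ⟹ α/e ∈ 𝔈_m`» used by TABLE Q's column `e`;
* §5 bookkeeping for the sequel: `e·α = 0 ↔ α = 0`, `Σ e·αᵢ = 0 ↔ Σ αᵢ = 0`, and LEMMA L (iii) `t'·(e·α) = e·(t̄'·α)` (`mul_levelMul_eq`).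

The level-raised character is passed as `β` with `hβ : ∀ i, β i = ((e * (α i).val : ℕ) : ZMod (e * m))` (the convention of
`Ring2AbelianAllFermatQuotientEtaleStep`, whose `val_levelMul` / `val_mul_levelMul` are reused), so that concrete TABLE-Q characters
instantiate by `decide`.  0 sorry, no `def`, no named fact; `HC_CM` does not occur.  Inputs: `FermatLevelMap*` (Shioda–Katsura level map,
finite, pull-back of algebraic classes), `SurjectivePullbackAlgebraicClasses` (degree trick), `DiagonalSymmetry` / `FermatDiagonalAction`
(the `μ`-action and `V(α)`), all PROVED tree files.
-/
noncomputable section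

open CategoryTheory AlgebraicGeometry
open Literature.AlgebraicGeometry.Motives Literature.AlgebraicGeometry.HodgeTheory
open Literature.AlgebraicTopology.SingularHomology Literature.NumberTheory.Transcendental
open Summit.HodgeConjecture.Ring2AbelianAll.FermatQuotientEtaleStep

namespace Summit.HodgeConjecture.Ring2AbelianAll.FermatLevelReduction

variable {n m e : ℕ}

/-! ### §1 The group side: `a ↦ aᵉ` maps `μ_{em}ⁿ⁺²` to `μ_mⁿ⁺²` and `χ_{eα}(a) = χ_α(aᵉ)` -/

/-- For `a ∈ μ_{em}ⁿ⁺²` the coordinatewise power `aᵉ` lies in `μ_mⁿ⁺²` (`(aᵢᵉ)ᵐ = aᵢ^{em} = 1`).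
[locator FERMAT-G33 §2 LEMMA L (ii)]  research route, not a corollary; conditional on HC_CM plus one named minimal statement. -/
theorem pow_mem_fermatGroup (a : fermatGroup n (e * m)) :
    (fun i ↦ (a : Fin (n + 2) → ℂˣ) i ^ e) ∈ fermatGroup n m := by
  refine mem_fermatGroup_iff.mpr fun i ↦ ?_
  rw [← pow_mul]
  exact mem_fermatGroup_iff.mp a.2 i

/-- **`χ_{e·α}(a) = χ_α(aᵉ)`**: the character of `μ_{em}ⁿ⁺²` attached to the level-raised exponent vector `e·α` is the character `χ_α` of
`μ_mⁿ⁺²` composed with `a ↦ aᵉ` (`⟨e·αᵢ⟩ = e·⟨αᵢ⟩`, `val_levelMul`).  [locator FERMAT-G33 §2 LEMMA L (ii)]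
research route, not a corollary; conditional on HC_CM plus one named minimal statement. -/
theorem fermatCharacter_levelMul (he : 0 < e) (hm : 0 < m) {α : Fin (n + 2) → ZMod m}
    {β : Fin (n + 2) → ZMod (e * m)} (hβ : ∀ i, β i = ((e * (α i).val : ℕ) : ZMod (e * m)))
    (a : fermatGroup n (e * m)) :
    fermatCharacter (e * m) β a = fermatCharacter m α ⟨_, pow_mem_fermatGroup a⟩ := by
  rw [fermatCharacter_apply, fermatCharacter_apply]
  refine Finset.prod_congr rfl fun i _ ↦ ?_
  rw [hβ i, val_levelMul he (α i) hm, pow_mul]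

/-! ### §2 Equivariance of the level map: `λ ∘ g_a = g_{aᵉ} ∘ λ` on complex points and on cohomology -/

/-- **Equivariance on complex points: `λ(g_a x) = g_{aᵉ}(λ x)`** for the level map `λ = fermatLevelMap n he hm : Xⁿ_{em} → Xⁿ_m` and
`a ∈ μ_{em}ⁿ⁺²`.  Both sides have homogeneous coordinates proportional to `(aᵢᵉ zᵢᵉ)ᵢ`, `[z]` the coordinates of `x`
(`hypersurfacePoint_map_fermatLevelMap`, `hypersurfacePoint_diagonalMap`), and the homogeneous-coordinate map of `Xⁿ_m` is injective.
[locator FERMAT-G33 §2 LEMMA L (ii)]  research route, not a corollary; conditional on HC_CM plus one named minimal statement. -/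
theorem map_fermatLevelMap_diagonalMap (he : 0 < e) (hm : 0 < m) (a : fermatGroup n (e * m))
    (x : ComplexPoints (fermatHypersurface n (e * m))) :
    AlgPoints.map (fermatLevelMap n he hm)
        (diagonalMap (fermatPolynomial ℂ n (e * m)) (fermatGroup_le_diagonalStabilizer (e * m) a.2) x) =
      diagonalMap (fermatPolynomial ℂ n m) (fermatGroup_le_diagonalStabilizer m (pow_mem_fermatGroup a))
        (AlgPoints.map (fermatLevelMap n he hm) x) := by
  set ιe := SmoothHypersurface.hypersurfaceι (fermatPolynomial ℂ n (e * m)) with hιe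
  set ιm := SmoothHypersurface.hypersurfaceι (fermatPolynomial ℂ n m) with hιm
  apply (isEmbedding_hypersurfacePoint ιm).injective
  -- coordinates of `x`
  set z := (hypersurfacePoint ιe x).rep with hz
  have hz0 : z ≠ 0 := Projectivization.rep_nonzero _
  have hw0 : (fun i ↦ ((a : Fin (n + 2) → ℂˣ) i : ℂ) ^ e * z i ^ e) ≠ 0 := by
    obtain ⟨i, hi⟩ := Function.ne_iff.mp hz0
    exact Function.ne_iff.mpr ⟨i, mul_ne_zero (pow_ne_zero _ (Units.ne_zero _)) (pow_ne_zero _ hi)⟩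
  -- left-hand side: `[((t a z)ᵢ)ᵉ] = [aᵢᵉ zᵢᵉ]`
  have hL : hypersurfacePoint ιm (AlgPoints.map (fermatLevelMap n he hm)
      (diagonalMap (fermatPolynomial ℂ n (e * m)) (fermatGroup_le_diagonalStabilizer (e * m) a.2) x)) =
      Projectivization.mk ℂ (fun i ↦ ((a : Fin (n + 2) → ℂˣ) i : ℂ) ^ e * z i ^ e) hw0 := by
    rw [hιm, hypersurfacePoint_map_fermatLevelMap he hm]
    obtain ⟨t, ht⟩ := exists_rep_hypersurfacePoint_diagonalMap (fermatPolynomial ℂ n (e * m))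
      (fermatGroup_le_diagonalStabilizer (e * m) a.2) x
    rw [Projectivization.mk_eq_mk_iff']
    refine ⟨t ^ e, ?_⟩
    funext i
    rw [← hιe, ht, Pi.smul_apply, Pi.smul_apply, smul_eq_mul, smul_apply_eq_mul, ← hz, smul_eq_mul]
    ring
  -- right-hand side: `[aᵢᵉ (s zᵉ)ᵢ] = [aᵢᵉ zᵢᵉ]`
  have hR : hypersurfacePoint ιm (diagonalMap (fermatPolynomial ℂ n m)
      (fermatGroup_le_diagonalStabilizer m (pow_mem_fermatGroup a)) (AlgPoints.map (fermatLevelMap n he hm) x)) =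
      Projectivization.mk ℂ (fun i ↦ ((a : Fin (n + 2) → ℂˣ) i : ℂ) ^ e * z i ^ e) hw0 := by
    rw [hιm, hypersurfacePoint_diagonalMap]
    obtain ⟨s, hs⟩ := exists_rep_hypersurfacePoint_map_fermatLevelMap (n := n) he hm x
    rw [Projectivization.mk_eq_mk_iff']
    refine ⟨s, ?_⟩
    funext i
    rw [Pi.smul_apply, smul_eq_mul, smul_apply_eq_mul, hs, Pi.smul_apply, smul_eq_mul, ← hιe, ← hz,
      Units.val_pow_eq_pow_val]
    ring
  rw [hL, hR]

/-- The same as an identity of continuous maps `Xⁿ_{em}(ℂ) → Xⁿ_m(ℂ)`: `λ(ℂ) ∘ g_a = g_{aᵉ} ∘ λ(ℂ)`.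
[locator FERMAT-G33 §2 LEMMA L (ii)]  research route, not a corollary; conditional on HC_CM plus one named minimal statement. -/
theorem mapContinuous_fermatLevelMap_comp_diagonalMap (he : 0 < e) (hm : 0 < m) (a : fermatGroup n (e * m)) :
    (AlgPoints.mapContinuous (L := ℂ) (fermatLevelMap n he hm)).comp
        (diagonalMap (fermatPolynomial ℂ n (e * m)) (fermatGroup_le_diagonalStabilizer (e * m) a.2)) =
      (diagonalMap (fermatPolynomial ℂ n m) (fermatGroup_le_diagonalStabilizer m (pow_mem_fermatGroup a))).comp
        (AlgPoints.mapContinuous (L := ℂ) (fermatLevelMap n he hm)) := by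
  ext x : 1
  simp only [ContinuousMap.comp_apply, AlgPoints.mapContinuous_apply]
  exact map_fermatLevelMap_diagonalMap he hm a x

/-- **Equivariance on cohomology: `g_a^*(λ^* c) = λ^*(g_{aᵉ}^* c)`** for every class `c ∈ Hᵏ(Xⁿ_m(ℂ); ℂ)` and `a ∈ μ_{em}ⁿ⁺²`
(contravariant functoriality of singular cohomology applied to §2's identity of continuous maps).
[locator FERMAT-G33 §2 LEMMA L (ii)]  research route, not a corollary; conditional on HC_CM plus one named minimal statement. -/
theorem map_diagonalMap_map_fermatLevelMap (he : 0 < e) (hm : 0 < m) (a : fermatGroup n (e * m)) (k : ℕ)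
    (c : complexBetti (fermatHypersurface n m) k) :
    singularCohomology.map ℂ ℂ (diagonalMap (fermatPolynomial ℂ n (e * m)) (fermatGroup_le_diagonalStabilizer (e * m) a.2)) k
        (complexBetti.map (fermatLevelMap n he hm) k c) =
      complexBetti.map (fermatLevelMap n he hm) k
        (singularCohomology.map ℂ ℂ (diagonalMap (fermatPolynomial ℂ n m)
          (fermatGroup_le_diagonalStabilizer m (pow_mem_fermatGroup a))) k c) := by
  have h := congrArg (fun f ↦ singularCohomology.map ℂ ℂ f k) (mapContinuous_fermatLevelMap_comp_diagonalMap he hm a)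
  simp only [singularCohomology.map_comp] at h
  exact congrArg (fun φ ↦ (ConcreteCategory.hom φ) c) h

/-- **`λ^* V_m(α) ⊆ V_{em}(e·α)`** in every degree `k`: the pull-back along the level map of a `χ_α`-eigenclass of `μ_mⁿ⁺²` is a
`χ_{eα}`-eigenclass of `μ_{em}ⁿ⁺²` (§2 equivariance + §1 `χ_{eα}(a) = χ_α(aᵉ)`).  This is «`λ^* V_{m′}(a′) ⊂ V_m(e a′)`» of FERMAT-G33 §2.1 (ii).
[locator FERMAT-G33 §2 LEMMA L (ii)]  research route, not a corollary; conditional on HC_CM plus one named minimal statement. -/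
theorem map_fermatEigenspace_le_levelMul (he : 0 < e) (hm : 0 < m) {α : Fin (n + 2) → ZMod m}
    {β : Fin (n + 2) → ZMod (e * m)} (hβ : ∀ i, β i = ((e * (α i).val : ℕ) : ZMod (e * m))) (k : ℕ) :
    (fermatEigenspace m α k).map (complexBetti.map (fermatLevelMap n he hm) k).hom ≤ fermatEigenspace (e * m) β k := by
  rintro _ ⟨c, hc, rfl⟩
  rw [mem_fermatEigenspace_iff]
  intro a
  have hc' := (mem_fermatEigenspace_iff.mp hc) ⟨_, pow_mem_fermatGroup a⟩
  change singularCohomology.map ℂ ℂ _ k (complexBetti.map (fermatLevelMap n he hm) k c) = _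
  rw [map_diagonalMap_map_fermatLevelMap he hm a k c, hc', map_smul, fermatCharacter_levelMul he hm hβ a]

/-! ### §3 The level map is surjective -/

/-- A universally closed morphism of `ℂ`-schemes locally of finite type which is onto on complex points is surjective (its image is closed
and contains the closed points, which are dense in the Jacobson target).  Local copy of the tree's `AlgPoints.surjective_of_map_surjective`
(`Motives/ComplexTorusIsogenyTransfer`), kept out of the import cone.  [folklore]
research route, not a corollary; conditional on HC_CM plus one named minimal statement. -/
private theorem surjective_of_map_surjective {X Y : SchemeOver ℂ} (f : X ⟶ Y)
    [LocallyOfFiniteType Y.hom] [UniversallyClosed f.left]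
    (h : Function.Surjective (AlgPoints.map (L := ℂ) f)) : AlgebraicGeometry.Surjective f.left := by
  haveI : JacobsonSpace ↥Y.left := LocallyOfFiniteType.jacobsonSpace Y.hom
  refine ⟨fun y ↦ ?_⟩
  have hcl : IsClosed (Set.range f.left.base) := f.left.isClosedMap.isClosed_range
  have hsub : closedPoints ↥Y.left ⊆ Set.range f.left.base := by
    intro y hy
    set Q : ComplexPoints Y := (ComplexPoints.equivClosedPoints Y).symm ⟨y, hy⟩ with hQ
    have hQy : Q.pt = y := by
      have := ComplexPoints.coe_equivClosedPoints_apply Y Q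
      rw [hQ, Equiv.apply_symm_apply] at this
      exact this.symm
    obtain ⟨P, hP⟩ := h Q
    exact ⟨P.pt, by rw [← hQy, ← hP, AlgPoints.pt_map]⟩
  have hy : y ∈ closure (closedPoints ↥Y.left) := by
    rw [closure_closedPoints]; exact Set.mem_univ y
  exact hcl.closure_subset_iff.2 hsub hy

/-- **The level map is onto on complex points**: `[w] = λ([z])` with `zᵢᵉ = wᵢ` (`ℂ` algebraically closed; `Σ zᵢ^{em} = Σ wᵢᵐ = 0`).
[locator FERMAT-G33 §2 LEMMA L (ii)]  research route, not a corollary; conditional on HC_CM plus one named minimal statement. -/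
theorem map_fermatLevelMap_surjective (he : 0 < e) (hm : 0 < m) :
    Function.Surjective (AlgPoints.map (L := ℂ) (fermatLevelMap n he hm)) := by
  intro y
  set ιe := SmoothHypersurface.hypersurfaceι (fermatPolynomial ℂ n (e * m)) with hιe
  set ιm := SmoothHypersurface.hypersurfaceι (fermatPolynomial ℂ n m) with hιm
  set w := (hypersurfacePoint ιm y).rep with hw
  have hw0 : w ≠ 0 := Projectivization.rep_nonzero _
  -- `e`-th roots of the coordinates
  have hroot : ∀ i, ∃ zi : ℂ, zi ^ e = w i := fun i ↦ IsAlgClosed.exists_pow_nat_eq (w i) he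
  choose z hz using hroot
  have hz0 : z ≠ 0 := by
    intro h0
    apply hw0
    funext i
    rw [← hz i, h0, Pi.zero_apply, zero_pow he.ne']
  -- `[z]` lies on `Xⁿ_{em}`
  have hwF : MvPolynomial.eval w (fermatPolynomial ℂ n m) = 0 :=
    eval_rep_eq_zero_of_mem_projZeroLocus (hypersurfacePoint_mem_projZeroLocus (ι := ιm)
      (isHomogeneous_fermatPolynomial n m) (SmoothHypersurface.range_hypersurfaceι _) y)
  have hzF : Projectivization.mk ℂ z hz0 ∈ Projectivization.projZeroLocus {fermatPolynomial ℂ n (e * m)} := by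
    rw [mk_mem_projZeroLocus_singleton_iff (isHomogeneous_fermatPolynomial n (e * m)), eval_fermatPolynomial]
    rw [eval_fermatPolynomial] at hwF
    rw [← hwF]
    refine Finset.sum_congr rfl fun i _ ↦ ?_
    rw [pow_mul, hz i]
  obtain ⟨x, hx⟩ := exists_hypersurfacePoint_eq (ι := ιe) (isHomogeneous_fermatPolynomial n (e * m))
    (SmoothHypersurface.range_hypersurfaceι _) hzF
  refine ⟨x, (isEmbedding_hypersurfacePoint ιm).injective ?_⟩
  rw [hιm, hypersurfacePoint_map_fermatLevelMap he hm, ← hιe]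
  conv_rhs => rw [← hιm, ← Projectivization.mk_rep (hypersurfacePoint ιm y)]
  rw [Projectivization.mk_eq_mk_iff']
  obtain ⟨t, ht⟩ := Projectivization.exists_smul_eq_mk_rep ℂ z hz0
  refine ⟨(t : ℂ) ^ e, ?_⟩
  funext i
  simp only [Pi.smul_apply, smul_eq_mul]
  rw [← hw, hx, ← ht, Pi.smul_apply, Units.smul_def, smul_eq_mul, mul_pow, hz i]

/-- **The level map `λ : Xⁿ_{em} → Xⁿ_m` is surjective** (as a morphism of schemes): finite (`isFinite_fermatLevelMap_left`), hence
universally closed, and onto on complex points.  [cite: ShiodaKatsura1979, §1]  [locator FERMAT-G33 §2 LEMMA L (ii)]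
research route, not a corollary; conditional on HC_CM plus one named minimal statement. -/
theorem surjective_fermatLevelMap (he : 0 < e) (hm : 0 < m) :
    AlgebraicGeometry.Surjective (fermatLevelMap n he hm).left := by
  haveI := isFinite_fermatLevelMap_left (n := n) he hm
  haveI : LocallyOfFiniteType (fermatHypersurface n m).hom := by
    rw [← Over.w (SmoothHypersurface.hypersurfaceι (fermatPolynomial ℂ n m))]; infer_instance
  exact surjective_of_map_surjective _ (map_fermatLevelMap_surjective he hm)

/-! ### §4 LEMMA L (ii), descent half: algebraicity of `V_{em}(e·α)` implies that of `V_m(α)` (every degree, every dimension `n ≥ 1`) -/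

/-- **LEMMA L (ii), descent**: if the level-raised eigenspace `V_{em}(e·α) ⊆ H²ᵖ(Xⁿ_{em}(ℂ); ℂ)` consists of algebraic classes, then so does
`V_m(α) ⊆ H²ᵖ(Xⁿ_m(ℂ); ℂ)` (`n ≥ 1`, `m, e ≥ 1`, any `p`).  Proof: `λ^* V_m(α) ⊆ V_{em}(e·α)` (§2) and algebraicity descends along the
surjective equidimensional `λ` by the degree trick `λ_* λ^* = c·id`, `c ≠ 0` (`mem_algebraicClasses_of_map_mem_of_surjective`).  This is the
direction «`α ∈ 𝔈_{em} ⟹ α/e ∈ 𝔈_m`» used by TABLE Q's column `e`.  [locator FERMAT-G33 §2 LEMMA L (ii)]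
research route, not a corollary; conditional on HC_CM plus one named minimal statement. -/
theorem fermatEigenspace_le_algebraicClasses_of_levelMul (hn : 1 ≤ n) (he : 0 < e) (hm : 0 < m)
    {α : Fin (n + 2) → ZMod m} {β : Fin (n + 2) → ZMod (e * m)}
    (hβ : ∀ i, β i = ((e * (α i).val : ℕ) : ZMod (e * m))) {p : ℕ}
    (h : fermatEigenspace (e * m) β (2 * p) ≤ algebraicClasses (fermatHypersurface n (e * m)) p) :
    fermatEigenspace m α (2 * p) ≤ algebraicClasses (fermatHypersurface n m) p := by
  haveI := surjective_fermatLevelMap (n := n) he hm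
  refine le_algebraicClasses_of_map_le_of_surjective (isSmoothProjective_fermatHypersurface hn (Nat.mul_pos he hm))
    (isSmoothProjective_fermatHypersurface hn hm) (fermatLevelMap n he hm) ?_
  exact (map_fermatEigenspace_le_levelMul he hm hβ (2 * p)).trans h

/-! ### §5 Bookkeeping: zero, sum and unit multiples of the level-raised character -/

/-- `e·αᵢ = 0 ↔ αᵢ = 0` coordinatewise (`levelMul_eq_zero_iff`), hence `e·α = 0 ↔ α = 0`.
[locator FERMAT-G33 §2 LEMMA L (i)]  research route, not a corollary; conditional on HC_CM plus one named minimal statement. -/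
theorem levelMul_eq_zero_iff_fun (he : 0 < e) (hm : 0 < m) {α : Fin (n + 2) → ZMod m}
    {β : Fin (n + 2) → ZMod (e * m)} (hβ : ∀ i, β i = ((e * (α i).val : ℕ) : ZMod (e * m))) :
    β = 0 ↔ α = 0 := by
  constructor
  · intro h; funext i
    exact (levelMul_eq_zero_iff he hm (α i)).mp (by rw [← hβ i, h]; rfl)
  · intro h; funext i
    rw [hβ i, h, Pi.zero_apply, ZMod.val_zero, mul_zero, Nat.cast_zero, Pi.zero_apply]

/-- `Σ e·αᵢ = 0 ↔ Σ αᵢ = 0` (`sum_map_levelMul_eq_zero_iff` on the multiset of coordinates).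
[locator FERMAT-G33 §2 LEMMA L (i)]  research route, not a corollary; conditional on HC_CM plus one named minimal statement. -/
theorem sum_levelMul_eq_zero_iff (he : 0 < e) (hm : 0 < m) {α : Fin (n + 2) → ZMod m}
    {β : Fin (n + 2) → ZMod (e * m)} (hβ : ∀ i, β i = ((e * (α i).val : ℕ) : ZMod (e * m))) :
    ∑ i, β i = 0 ↔ ∑ i, α i = 0 := by
  have h := sum_map_levelMul_eq_zero_iff he hm ((Finset.univ : Finset (Fin (n + 2))).val.map α)
  rw [Multiset.map_map] at h
  have h1 : ((Finset.univ : Finset (Fin (n + 2))).val.map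
      ((fun a : ZMod m ↦ ((e * a.val : ℕ) : ZMod (e * m))) ∘ α)).sum = ∑ i, β i := by
    rw [Finset.sum_eq_multiset_sum]
    congr 1
    exact Multiset.map_congr rfl fun i _ ↦ (hβ i).symm
  have h2 : ((Finset.univ : Finset (Fin (n + 2))).val.map α).sum = ∑ i, α i := (Finset.sum_eq_multiset_sum _ _).symm
  rw [h1, h2] at h
  exact h

/-- **LEMMA L (iii), coordinate form: `t'·(e·α) = e·(t̄'·α)`** in `ℤ/em`, `t̄' = t' mod m` (`val_mul_levelMul`): multiplying the
level-raised character by a residue mod `em` is level-raising the character multiplied by its reduction.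
[locator FERMAT-G33 §2 LEMMA L (iii)]  research route, not a corollary; conditional on HC_CM plus one named minimal statement. -/
theorem mul_levelMul_eq (he : 0 < e) (hm : 0 < m) (t' : ZMod (e * m)) (a : ZMod m) :
    t' * ((e * a.val : ℕ) : ZMod (e * m)) = ((e * ((ZMod.cast t' : ZMod m) * a).val : ℕ) : ZMod (e * m)) := by
  haveI : NeZero (e * m) := ⟨(Nat.mul_pos he hm).ne'⟩
  apply ZMod.val_injective
  rw [val_mul_levelMul he hm t' a, val_levelMul he _ hm]

end Summit.HodgeConjecture.Ring2AbelianAll.FermatLevelReduction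

end
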